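import Literature.NumberTheory.Transcendental.OnePeriodsClosedPathsHyperbola
import Mathlib.Analysis.Calculus.Deriv.Polynomial
import Mathlib.RingTheory.MvPolynomial.Tower
import Mathlib.Algebra.Polynomial.Laurent
import HarnessLib

/-!
# Complete periods of plane curves: polynomially parametrised loops and graphs (genus `0`, I)

Companion of `Literature/NumberTheory/Transcendental/OnePeriodsClosedPaths.lean` (the named fact
`Literature.NumberTheory.Transcendental.completePlaneCurvePeriods_zero_or_transcendental`:
complete periods `S = Σᵢ nᵢ ∮_{γᵢ} (A dx + B dy)` of polynomial `1`-forms over `ℚ` along closed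
`C¹` loops in the smooth locus of a plane curve `p = 0` over `ℚ` are `0` or transcendental;
Huber–Wüstholz, *Transcendence and Linear Relations of 1-Periods*, Cambridge Tracts 227 (2022),
Cor. 13.13, p. 126 of the held text), of `OnePeriodsClosedPathsProofs.lean` (exact forms) and of
`OnePeriodsClosedPathsHyperbola.lean` (the curve `xy = 1`).

This file proves the fact outright on the part of genus `0` that needs NO transcendence input:
loops that factor through a polynomial map `Φ : ℂ → ℂ²`.  If `γ(t) = Φ(θ(t))` for a closed `C¹`
loop `θ : ℝ → ℂ` and `Φ = (Φ₀, Φ₁) ∈ ℂ[s]²`, then for ALL polynomial forms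
`∮_γ (A dx + B dy) = ∮_θ h(s) ds = 0` with `h = (A∘Φ) Φ₀′ + (B∘Φ) Φ₁′ ∈ ℂ[s]` (every polynomial
form on the affine line is exact: Huber–Wüstholz, Lemma 12.4 / the case `C = ℙ¹`, `C° = 𝔸¹` of
Thm. 13.9, where all periods over closed paths vanish).  In particular the named fact holds — all
complete periods simply vanish — for every curve that is the graph `y = g(x)` of a polynomial
`g ∈ ℚ[x]` (lines, parabolas, …): `completePlaneCurvePeriods_zero_or_transcendental_graph`.
The file also records the endgame shared by all genus-`0` slices: an ALGEBRAIC multiple `c · 2πi`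
of `2πi` is algebraic only if `c = 0` (Lindemann), `eq_zero_of_isAlgebraic_mul_two_pi_I`.

## Main statements (all proved, no named facts used)

* `ClosedPathPeriods.integral_pow_mul_deriv_eq_zero`, `…integral_eval_mul_deriv_eq_zero` —
  `∮ θ^m dθ = 0`, `∮ h(θ) dθ = 0` along a closed `C¹` loop `θ : ℝ → ℂ`, `h ∈ ℂ[s]`.
* `ClosedPathPeriods.integral_form_eq_zero_of_param` — polynomially parametrised loops have zero
  complete periods, for forms with coefficients in any ring `R → ℂ`.
* `ClosedPathPeriods.integral_form_eq_zero_of_graph` / `…_of_graph'` — loops on a graph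
  `y = g(x)` / `x = g(y)`, `g ∈ ℂ[s]`.
* `completePlaneCurvePeriods_zero_or_transcendental_graph` — the named fact for `p = y − g(x)`,
  `g ∈ ℚ[x]`, in the exact shape of the fact (conclusion even without the algebraicity premise).
* `ClosedPathPeriods.eq_zero_of_isAlgebraic_mul_two_pi_I` — `c ∈ ℚ̄`, `c · 2πi ∈ ℚ̄ ⇒ c = 0`.

## References

* A. Huber, G. Wüstholz, *Transcendence and Linear Relations of 1-Periods*, Cambridge Tracts in
  Mathematics 227, CUP 2022, doi:10.1017/9781009019729 [HuberWustholz2022]: Cor. 13.13 (p. 126),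
  Thm. 13.9 (p. 125), Lemma 12.4 (p. 114).
* F. Lindemann, *Über die Zahl π*, Math. Ann. 20 (1882) [Lindemann1882].
-/

noncomputable section

open MvPolynomial Complex
open scoped Real Polynomial

namespace Literature.NumberTheory.Transcendental

namespace ClosedPathPeriods

open Literature.Topology.PlaneTopology Literature.Analysis.Complex

/-! ### Polynomial forms `h(θ) dθ` along a closed loop in `ℂ` -/

section OneVariable

variable {θ : ℝ → ℂ}

/-- **`∮ θ^m dθ = 0`** (`m ∈ ℕ`) along a `C¹` loop `θ : ℝ → ℂ` with `θ 0 = θ 1`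
(`θ^m dθ = d(θ^{m+1}/(m+1))`). [folklore] -/
theorem integral_pow_mul_deriv_eq_zero (hθ : ContDiff ℝ 1 θ) (h01 : θ 0 = θ 1) (m : ℕ) :
    (∫ t in (0:ℝ)..1, θ t ^ m * deriv θ t) = 0 := by
  have hm1 : ((m : ℂ) + 1) ≠ 0 := by exact_mod_cast Nat.succ_ne_zero m
  have hθd : ∀ t, HasDerivAt θ (deriv θ t) t := fun t =>
    ((hθ.differentiable one_ne_zero) t).hasDerivAt
  have hprim : ∀ t, HasDerivAt (fun s => θ s ^ (m + 1))
      (((m : ℂ) + 1) * (θ t ^ m * deriv θ t)) t := by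
    intro t
    have h := (hasDerivAt_pow (m + 1) (θ t)).comp t (hθd t)
    have e : ((m + 1 : ℕ) : ℂ) * θ t ^ (m + 1 - 1) * deriv θ t =
        ((m : ℂ) + 1) * (θ t ^ m * deriv θ t) := by
      rw [Nat.add_sub_cancel, Nat.cast_succ, mul_assoc]
    rwa [e] at h
  have hcont : Continuous fun t => θ t ^ m * deriv θ t :=
    (hθ.continuous.pow m).mul (hθ.continuous_deriv le_rfl)
  have hint : (∫ t in (0:ℝ)..1, ((m : ℂ) + 1) * (θ t ^ m * deriv θ t)) =
      θ 1 ^ (m + 1) - θ 0 ^ (m + 1) :=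
    intervalIntegral.integral_eq_sub_of_hasDerivAt (fun t _ => hprim t)
      ((continuous_const.mul hcont).intervalIntegrable 0 1)
  rw [intervalIntegral.integral_const_mul, h01, sub_self, mul_eq_zero] at hint
  exact hint.resolve_left hm1

/-- The integrand `h(θ(t)) θ′(t)` is interval integrable (continuous). [folklore] -/
theorem intervalIntegrable_eval_mul_deriv (hθ : ContDiff ℝ 1 θ) (h : ℂ[X]) (a b : ℝ) :
    IntervalIntegrable (fun t => h.eval (θ t) * deriv θ t) MeasureTheory.volume a b :=
  ((h.continuous.comp hθ.continuous).mul (hθ.continuous_deriv le_rfl)).intervalIntegrable a b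

/-- **`∮ h(θ) dθ = 0`** for every polynomial `h ∈ ℂ[s]` along a `C¹` loop `θ : ℝ → ℂ` with
`θ 0 = θ 1`: every polynomial `1`-form on the affine line is exact (Huber–Wüstholz, Lemma 12.4:
the periods of `𝔸¹` over closed paths vanish). [cite: HuberWustholz2022, Lemma 12.4 (p. 114)] -/
theorem integral_eval_mul_deriv_eq_zero (hθ : ContDiff ℝ 1 θ) (h01 : θ 0 = θ 1) (h : ℂ[X]) :
    (∫ t in (0:ℝ)..1, h.eval (θ t) * deriv θ t) = 0 := by
  induction h using Polynomial.induction_on' with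
  | add p q hp hq =>
    simp_rw [Polynomial.eval_add, add_mul]
    rw [intervalIntegral.integral_add (intervalIntegrable_eval_mul_deriv hθ p 0 1)
      (intervalIntegrable_eval_mul_deriv hθ q 0 1), hp, hq, add_zero]
  | monomial n a =>
    simp_rw [Polynomial.eval_monomial, mul_assoc]
    rw [intervalIntegral.integral_const_mul, integral_pow_mul_deriv_eq_zero hθ h01 n, mul_zero]

end OneVariable

/-! ### Polynomially parametrised loops in `ℂ²` -/

section Param

variable {R : Type*} [CommRing R] [Algebra R ℂ]
variable {γ : ℝ → (Fin 2 → ℂ)} {θ : ℝ → ℂ}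

/-- Substituting polynomials `Φᵢ(s)` for the variables and then evaluating at `s = z` is
evaluating at the point `(Φᵢ(z))ᵢ`. [folklore] -/
theorem eval_aeval_polynomial {n : ℕ} (Φ : Fin n → ℂ[X]) (Q : MvPolynomial (Fin n) ℂ) (z : ℂ) :
    (MvPolynomial.aeval Φ Q).eval z = MvPolynomial.aeval (fun i => (Φ i).eval z) Q := by
  have h := MvPolynomial.comp_aeval_apply (Polynomial.aeval z : ℂ[X] →ₐ[ℂ] ℂ) (f := Φ) Q
  simpa only [Polynomial.coe_aeval_eq_eval] using h

/-- **Polynomially parametrised loops have zero complete periods.**  If `γ(t) = Φ(θ(t))` with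
`Φ = (Φ₀, Φ₁) ∈ ℂ[s]²` and `θ : ℝ → ℂ` a `C¹` loop with `θ 0 = θ 1`, then
`∮_γ (A dx + B dy) = ∮_θ ((A∘Φ) Φ₀′ + (B∘Φ) Φ₁′)(s) ds = 0` for all polynomial forms `A dx + B dy`
with coefficients in any ring `R` mapping to `ℂ` (chain rule, then
`integral_eval_mul_deriv_eq_zero`).  This is the case `C° ≅ 𝔸¹` of Huber–Wüstholz, Thm. 13.9 /
Cor. 13.13, where no transcendence is involved. [cite: HuberWustholz2022, Lemma 12.4 (p. 114), Cor. 13.13 (p. 126)] -/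
theorem integral_form_eq_zero_of_param (hθ : ContDiff ℝ 1 θ) (h01 : θ 0 = θ 1)
    (Φ : Fin 2 → ℂ[X]) (hΦ : ∀ t i, γ t i = (Φ i).eval (θ t)) (A B : MvPolynomial (Fin 2) R) :
    (∫ t in (0:ℝ)..1, (aeval (γ t) A * deriv (fun s => γ s 0) t +
        aeval (γ t) B * deriv (fun s => γ s 1) t)) = 0 := by
  have hθd : ∀ t, HasDerivAt θ (deriv θ t) t := fun t =>
    ((hθ.differentiable one_ne_zero) t).hasDerivAt
  -- chain rule for the coordinates `γᵢ = Φᵢ ∘ θ`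
  have hd : ∀ i t, deriv (fun s => γ s i) t =
      (Polynomial.derivative (Φ i)).eval (θ t) * deriv θ t := by
    intro i t
    have hfun : (fun s => γ s i) = fun s => (Φ i).eval (θ s) := funext fun s => hΦ s i
    rw [hfun]
    exact (((Φ i).hasDerivAt (θ t)).comp t (hθd t)).deriv
  -- the pulled-back form `h(s) ds`
  set A' : MvPolynomial (Fin 2) ℂ := map (algebraMap R ℂ) A with hA'
  set B' : MvPolynomial (Fin 2) ℂ := map (algebraMap R ℂ) B with hB'
  set h : ℂ[X] := MvPolynomial.aeval Φ A' * Polynomial.derivative (Φ 0) +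
    MvPolynomial.aeval Φ B' * Polynomial.derivative (Φ 1) with hh
  have hint : ∀ t, aeval (γ t) A * deriv (fun s => γ s 0) t +
      aeval (γ t) B * deriv (fun s => γ s 1) t = h.eval (θ t) * deriv θ t := by
    intro t
    have hγt : (fun i => (Φ i).eval (θ t)) = γ t := funext fun i => (hΦ t i).symm
    have eA : aeval (γ t) A = (MvPolynomial.aeval Φ A').eval (θ t) := by
      rw [eval_aeval_polynomial, hγt, hA', aeval_map_algebraMap]
    have eB : aeval (γ t) B = (MvPolynomial.aeval Φ B').eval (θ t) := by
      rw [eval_aeval_polynomial, hγt, hB', aeval_map_algebraMap]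
    rw [hd 0 t, hd 1 t, eA, eB, hh]
    simp only [Polynomial.eval_add, Polynomial.eval_mul]
    ring
  simp_rw [hint]
  exact integral_eval_mul_deriv_eq_zero hθ h01 h

/-- **Loops on a graph `y = g(x)` have zero complete periods** (`g ∈ ℂ[s]`; the loop is
`(x, g(x))` with `x = γ₀` a closed `C¹` loop). [cite: HuberWustholz2022, Lemma 12.4 (p. 114)] -/
theorem integral_form_eq_zero_of_graph (hγ : ContDiff ℝ 1 γ) (hper : Function.Periodic γ 1)
    (g : ℂ[X]) (hg : ∀ t, γ t 1 = g.eval (γ t 0)) (A B : MvPolynomial (Fin 2) R) :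
    (∫ t in (0:ℝ)..1, (aeval (γ t) A * deriv (fun s => γ s 0) t +
        aeval (γ t) B * deriv (fun s => γ s 1) t)) = 0 := by
  have h01 : γ 0 0 = γ 1 0 := by
    have := hper 0
    rw [zero_add] at this
    exact (congrFun this 0).symm
  refine integral_form_eq_zero_of_param (θ := fun s => γ s 0) (contDiff_pi.1 hγ 0) h01
    ![Polynomial.X, g] (fun t i => ?_) A B
  fin_cases i
  · simp
  · simpa using hg t

/-- **Loops on a graph `x = g(y)` have zero complete periods** (`g ∈ ℂ[s]`).
[cite: HuberWustholz2022, Lemma 12.4 (p. 114)] -/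
theorem integral_form_eq_zero_of_graph' (hγ : ContDiff ℝ 1 γ) (hper : Function.Periodic γ 1)
    (g : ℂ[X]) (hg : ∀ t, γ t 0 = g.eval (γ t 1)) (A B : MvPolynomial (Fin 2) R) :
    (∫ t in (0:ℝ)..1, (aeval (γ t) A * deriv (fun s => γ s 0) t +
        aeval (γ t) B * deriv (fun s => γ s 1) t)) = 0 := by
  have h01 : γ 0 1 = γ 1 1 := by
    have := hper 0
    rw [zero_add] at this
    exact (congrFun this 1).symm
  refine integral_form_eq_zero_of_param (θ := fun s => γ s 1) (contDiff_pi.1 hγ 1) h01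
    ![g, Polynomial.X] (fun t i => ?_) A B
  fin_cases i
  · simpa using hg t
  · simp

end Param

/-! ### The endgame of every genus-`0` slice: Lindemann -/

/-- An ALGEBRAIC multiple `c · 2πi` of `2πi` (`c ∈ ℚ̄`) is algebraic only if `c = 0`: otherwise
`2πi = c⁻¹ · (c · 2πi)` would be algebraic, contradicting Lindemann's theorem
(`rat_eq_zero_of_isAlgebraic_mul_two_pi_I`, from `transcendental_pi_holds`).
[cite: Lindemann1882, via BakerTNT1975 Ch. 1 Theorem 1.3, p. 5] -/
theorem eq_zero_of_isAlgebraic_mul_two_pi_I {c : ℂ} (hc : IsAlgebraic ℚ c)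
    (halg : IsAlgebraic ℚ (c * (2 * π * I))) : c = 0 := by
  by_contra h0
  have h2 : IsAlgebraic ℚ ((2 : ℂ) * π * I) := by
    have e : ((2 : ℂ) * π * I) = c⁻¹ * (c * (2 * π * I)) := by
      rw [← mul_assoc, inv_mul_cancel₀ h0, one_mul]
    rw [e]
    exact hc.inv.mul halg
  have h1 : (1 : ℚ) = 0 :=
    rat_eq_zero_of_isAlgebraic_mul_two_pi_I (q := 1) (by rwa [map_one, one_mul])
  exact one_ne_zero h1

/-! ### Laurent polynomial forms along a loop in `ℂ*` and Laurent-parametrised loops -/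

section Laurent

open LaurentPolynomial

variable {K : Type*} [CommRing K] [Algebra K ℂ]
variable {u : ℝ → ℂ}

/-- `t ↦ L(u(t))` is continuous for a Laurent polynomial `L` and a continuous nowhere-vanishing
`u`. [folklore] -/
theorem continuous_laurent_eval₂ (hu : Continuous u) (h0 : ∀ t, u t ≠ 0) (L : K[T;T⁻¹]) :
    Continuous fun t => LaurentPolynomial.eval₂ (algebraMap K ℂ) (Units.mk0 (u t) (h0 t)) L := by
  induction L using LaurentPolynomial.induction_on' with
  | add p q hp hq =>
    simp only [map_add]
    exact hp.add hq
  | C_mul_T n a =>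
    simp only [eval₂_C_mul_T, Units.val_zpow_eq_zpow_val, Units.val_mk0]
    exact continuous_const.mul (hu.zpow₀ n fun t => Or.inl (h0 t))

omit [Algebra K ℂ] in
/-- The coefficient of `T⁻¹` in the Laurent monomial `a Tⁿ`. [folklore] -/
theorem coeff_C_mul_T_neg_one (a : K) (n : ℤ) :
    (LaurentPolynomial.C a * T n).coeff (-1) = if n = -1 then a else 0 := by
  rw [← single_eq_C_mul_T, AddMonoidAlgebra.coeff_single, Finsupp.single_apply]

/-- **The residue theorem on `ℂ*` for Laurent polynomial forms**: along a nowhere-vanishing `C¹`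
loop `u : ℝ → ℂ*` with `u 0 = u 1`, `∮ L(u) du = Res₀(L du) · wind(u) · 2πi`, where
`Res₀(L du)` is the coefficient of `T⁻¹` in `L ∈ K[T;T⁻¹]` (`∮ uⁿ du = 0` for `n ≠ −1`,
`∮ u⁻¹ du = 2πi · wind u`). [folklore] -/
theorem integral_laurent_eval₂_mul_deriv (hu : ContDiff ℝ 1 u) (h0 : ∀ t, u t ≠ 0)
    (h01 : u 0 = u 1) (L : K[T;T⁻¹]) :
    (∫ t in (0:ℝ)..1, LaurentPolynomial.eval₂ (algebraMap K ℂ) (Units.mk0 (u t) (h0 t)) L *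
        deriv u t) = algebraMap K ℂ (L.coeff (-1)) * (wind u * (2 * π * I)) := by
  induction L using LaurentPolynomial.induction_on' with
  | add p q hp hq =>
    have hi : ∀ M : K[T;T⁻¹], IntervalIntegrable (fun t =>
        LaurentPolynomial.eval₂ (algebraMap K ℂ) (Units.mk0 (u t) (h0 t)) M * deriv u t)
        MeasureTheory.volume 0 1 := fun M =>
      ((continuous_laurent_eval₂ hu.continuous h0 M).mul
        (hu.continuous_deriv le_rfl)).intervalIntegrable 0 1
    simp_rw [map_add, add_mul]
    rw [intervalIntegral.integral_add (hi p) (hi q), hp, hq, AddMonoidAlgebra.coeff_add,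
      Finsupp.add_apply, map_add, add_mul]
  | C_mul_T n a =>
    simp_rw [eval₂_C_mul_T, Units.val_zpow_eq_zpow_val, Units.val_mk0, mul_assoc]
    rw [intervalIntegral.integral_const_mul, coeff_C_mul_T_neg_one]
    by_cases hn : n = -1
    · subst hn
      rw [integral_zpow_neg_one_mul_deriv hu h0 h01, if_pos rfl]
      ring
    · rw [integral_zpow_mul_deriv_eq_zero hu h0 h01 hn, if_neg hn, map_zero, zero_mul, mul_zero]

/-- Evaluating `A(Ψ₀, Ψ₁) ∈ K[T;T⁻¹]` at `T = u` is evaluating `A` at the point `(Ψ₀(u), Ψ₁(u))`.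
[folklore] -/
theorem laurent_eval₂_aeval (Ψ : Fin 2 → K[T;T⁻¹]) (A : MvPolynomial (Fin 2) K) (w : ℂˣ) :
    LaurentPolynomial.eval₂ (algebraMap K ℂ) w (MvPolynomial.aeval Ψ A) =
      MvPolynomial.aeval (fun i => LaurentPolynomial.eval₂ (algebraMap K ℂ) w (Ψ i)) A := by
  rw [MvPolynomial.map_aeval, MvPolynomial.aeval_def, MvPolynomial.coe_eval₂Hom]
  congr 1
  ext r
  simp

variable {γ : ℝ → (Fin 2 → ℂ)}

/-- **Laurent-parametrised loops: complete periods are algebraic multiples of `2πi`.**  If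
`γ(t) = Ψ(u(t))` with `Ψ = (Ψ₀, Ψ₁) ∈ K[T;T⁻¹]²`, `u : ℝ → ℂ*` a nowhere-vanishing `C¹` loop with
`u 0 = u 1`, and `γᵢ′ = Ψᵢ′(u) u′` for Laurent polynomials `Ψᵢ′` (the formal derivatives), then
for all polynomial forms with coefficients in `K`

  `∮_γ (A dx + B dy) = Res₀((A∘Ψ) Ψ₀′ + (B∘Ψ) Ψ₁′) · wind(u) · 2πi`,

the residue being the coefficient of `T⁻¹`, an element of `K` (for `K ⊆ ℚ̄` an algebraic
number): the residue theorem on the twice-punctured sphere, i.e. the curve `𝔾_m`, whose only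
period is `2πi` (Huber–Wüstholz, Remark 13.10: the genus-`0` content of Thm. 13.9 is the
transcendence of `π`). [cite: HuberWustholz2022, Remark 13.10 (p. 125), Cor. 13.13 (p. 126)] -/
theorem integral_form_of_laurentParam (hu : ContDiff ℝ 1 u) (h0 : ∀ t, u t ≠ 0)
    (h01 : u 0 = u 1) (Ψ Ψ' : Fin 2 → K[T;T⁻¹])
    (hΨ : ∀ t i, γ t i = LaurentPolynomial.eval₂ (algebraMap K ℂ) (Units.mk0 (u t) (h0 t)) (Ψ i))
    (hΨ' : ∀ t i, deriv (fun s => γ s i) t =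
      LaurentPolynomial.eval₂ (algebraMap K ℂ) (Units.mk0 (u t) (h0 t)) (Ψ' i) * deriv u t)
    (A B : MvPolynomial (Fin 2) K) :
    (∫ t in (0:ℝ)..1, (aeval (γ t) A * deriv (fun s => γ s 0) t +
        aeval (γ t) B * deriv (fun s => γ s 1) t)) =
      algebraMap K ℂ ((MvPolynomial.aeval Ψ A * Ψ' 0 + MvPolynomial.aeval Ψ B * Ψ' 1).coeff (-1)) *
        (wind u * (2 * π * I)) := by
  rw [← integral_laurent_eval₂_mul_deriv hu h0 h01]
  refine intervalIntegral.integral_congr fun t _ => ?_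
  have hγt : (fun i => LaurentPolynomial.eval₂ (algebraMap K ℂ) (Units.mk0 (u t) (h0 t)) (Ψ i)) =
      γ t := funext fun i => (hΨ t i).symm
  simp only [map_add, map_mul, laurent_eval₂_aeval, hγt, hΨ' t 0, hΨ' t 1]
  ring

end Laurent

end ClosedPathPeriods

/-! ### The named fact for graphs `y = g(x)` over `ℚ` -/

/-- **The graph slice of the named fact is a theorem** (and trivially so: all complete periods
vanish): for `g ∈ ℚ[x]` and the curve `p = y − g(x)` (smooth everywhere, `≅ 𝔸¹`), every
complete period `Σᵢ nᵢ ∮_{γᵢ} (A dx + B dy)` along closed `C¹` loops on `p = 0` is `0` — lines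
`y = ax + b` and parabolas included.  Stated in the exact shape of
`completePlaneCurvePeriods_zero_or_transcendental` (whose algebraicity premise is not even needed
here). [cite: HuberWustholz2022, Cor. 13.13 (p. 126); Lemma 12.4 (p. 114) for `𝔸¹`] -/
theorem completePlaneCurvePeriods_zero_or_transcendental_graph (g : ℚ[X])
    (A B : MvPolynomial (Fin 2) ℚ) (k : ℕ) (n : Fin k → ℤ) (γ : Fin k → ℝ → (Fin 2 → ℂ))
    (hγ : ∀ i, ContDiff ℝ 1 (γ i) ∧ Function.Periodic (γ i) 1 ∧
      ∀ t, aeval (γ i t) (X 1 - Polynomial.aeval (X 0) g : MvPolynomial (Fin 2) ℚ) = 0 ∧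
        ∃ j, aeval (γ i t) (pderiv j (X 1 - Polynomial.aeval (X 0) g : MvPolynomial (Fin 2) ℚ)) ≠ 0) :
    (∑ i, (n i : ℂ) * ∫ t in (0:ℝ)..1,
      (aeval (γ i t) A * deriv (fun s => γ i s 0) t +
        aeval (γ i t) B * deriv (fun s => γ i s 1) t)) = 0 := by
  refine Finset.sum_eq_zero fun i _ => ?_
  have hg : ∀ t, γ i t 1 = (g.map (algebraMap ℚ ℂ)).eval (γ i t 0) := by
    intro t
    have h := ((hγ i).2.2 t).1
    rw [map_sub, aeval_X, ← Polynomial.aeval_algHom_apply, aeval_X, sub_eq_zero,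
      Polynomial.aeval_def, ← Polynomial.eval_map] at h
    exact h
  rw [ClosedPathPeriods.integral_form_eq_zero_of_graph (hγ i).1 (hγ i).2.1 _ hg A B, mul_zero]

end Literature.NumberTheory.Transcendental

end
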